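import Literature.RepresentationTheory.CompactAbelianFiniteLevelTraces
import HarnessLib

/-!
# Complementary type sets of two multiplicity-free representations of a compact abelian group from a finite-level
# character relation (the abstract half of the `(U(1), U(1))` theta dichotomy)

Topic `RepresentationTheory`; namespace `Literature.RepresentationTheory.TwistedCoinv` (continuing
`TwistedCoinvariantsTypePeriodicity`, `CompactAbelianFiniteLevelTraces`).  KERNEL ONLY: theorems, 0 definitions,
0 named facts, 0 `sorry`.  `K` is a compact group whose elements commute (`hcomm`; the target is the torus
`E_v¹ = U(J₁)(F_v)`), `S^{L} = ρ.fixedPoints L`, and MULTIPLICITY ONE means: every open-kernel character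
`χ : K →* ℂˣ` has a finite-dimensional weight space `weightSpace ρ id χ` of dimension `≤ 1`.

* §1 (a surjection `π : K →* A` onto a FINITE ABELIAN group with open kernel; in the application `A = K/L`):
  **`trace_fixedPoints_ker_eq_sum`** — `tr(ρ(t) | S^{ker π}) = Σ_ψ dim S[ψ ∘ π] · ψ(π t)` over the characters `ψ` of
  `A` (`trace_eq_sum_finrank_weightSpace` for the representation of `A` on `S^{ker π}` + identification of weight
  spaces); bookkeeping `exists_addChar_of_ker_le` / `exists_monoidHom_of_addChar`.
* §2 **`finrank_weightSpace_add_eq_one_of_trace_eq_neg`** — THE DICHOTOMY: for multiplicity-one `ρ₁, ρ₂`, `z₁` with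
  `z₁² = 1`, an open-kernel `θ`, the local relation «`tr(ρ₂(u) | S₂^{L}) = -θ(u) tr(ρ₁(u) | S₁^{L})` for `u` near any
  `z ∉ {1, z₁}` and `L` small» and ONE reflection asymmetry `‖tr(ρ₁(z₁ z)|S₁^{L})‖ ≠ ‖tr(ρ₁(z)|S₁^{L})‖` give
  `dim S₁[ξ] + dim S₂[ξ θ] = 1` for every open-kernel `ξ` — COMPLEMENTARY type sets up to the shift `θ`.  (At a deep
  level `L` the traces are character sums on the dual of `K/L`; the relation descends from deeper levels by the
  averaging identity and the compactness of `z L`; two-point support + the combinatorial core of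
  `CompactAbelianFiniteLevelTraces`.)  Application: cell `hodgecm-mathlib`, h413 road, SOCKETS-H413 v0.2 §3 S6 «G2a»
  = the `(U(1), U(1))` dichotomy [Moen 1987; Harris–Kudla–Sweet 1996 §8; Gelbart–Rogawski 1991 Cor. 5.2.2] by the
  CHARACTER ROUTE (the relation is Howe's finite-level character of the two oscillator representations, whose ratio is
  `(δ₂/δ₁, d)_v = -1` times a character).  Count-neutral; HC_CM is proved only modulo the 7 printed citations.

## References
* [BernsteinZelevinsky1976] I. N. Bernstein, A. V. Zelevinsky, Russian Math. Surveys 31 (1976), §2.1–2.3.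
* [Serre1977] J.-P. Serre, *Linear representations of finite groups*, GTM 42 (1977), §2.3, §2.6 Thm. 8.
-/

set_option autoImplicit false

noncomputable section

open scoped BigOperators

namespace Literature.RepresentationTheory.TwistedCoinv

/-! ## §1. Finite-level traces through a finite abelian quotient `π : K →* A` -/

section Quotient

variable {K : Type*} [Group K] [TopologicalSpace K] [IsTopologicalGroup K] [CompactSpace K]
  {S : Type*} [AddCommGroup S] [Module ℂ S] (ρ : Representation ℂ K S)
  {A : Type*} [CommGroup A] [Fintype A] (π : K →* A)




omit [TopologicalSpace K] [IsTopologicalGroup K] [CompactSpace K] [Fintype A] in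
/-- A vector in the weight space of `k ↦ ψ(π k)` is `ker π`-fixed. [cite: BernsteinZelevinsky1976, §2.1] -/
theorem mem_fixedPoints_ker_of_mem_weightSpace (L : Subgroup K) (hL : π.ker = L) (ψ : AddChar (Additive A) ℂ)
    {v : S} (hv : v ∈ weightSpace ρ id (fun k => ψ (Additive.ofMul (π k)))) : v ∈ ρ.fixedPoints L := by
  subst hL
  rw [Representation.mem_fixedPoints]
  intro g hg
  rw [mem_weightSpace] at hv
  rw [show ρ g v = ρ (id g) v from rfl, hv g, (MonoidHom.mem_ker).1 hg, ofMul_one, AddChar.map_zero_eq_one, one_smul]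

omit [TopologicalSpace K] [IsTopologicalGroup K] [CompactSpace K] [Fintype A] in
/-- `ρ(k)` restricted to `S^{ker π}` depends only on `π k`. [cite: BernsteinZelevinsky1976, §2.1] -/
theorem restrict_eq_restrict_of_apply_eq (hcomm : ∀ a b : K, a * b = b * a) (L : Subgroup K) (hL : π.ker = L)
    {k k' : K} (h : π k = π k') :
    (ρ k).restrict (apply_mem_fixedPoints_of_comm ρ hcomm L k) =
      (ρ k').restrict (apply_mem_fixedPoints_of_comm ρ hcomm L k') := by
  subst hL
  apply LinearMap.ext
  intro w
  apply Subtype.ext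
  simp only [LinearMap.restrict_apply]
  have hmem : k'⁻¹ * k ∈ π.ker := by
    rw [MonoidHom.mem_ker, map_mul, map_inv, h, inv_mul_cancel]
  have hw := (Representation.mem_fixedPoints ρ π.ker (w : S)).1 w.2 _ hmem
  calc ρ k w = ρ (k' * (k'⁻¹ * k)) w := by rw [mul_inv_cancel_left]
    _ = ρ k' (ρ (k'⁻¹ * k) w) := by rw [map_mul, Module.End.mul_apply]
    _ = ρ k' w := by rw [hw]

/-- **The finite-level trace identity through a finite abelian quotient** `π : K →* A` (surjective, open kernel,
elements of `K` commuting, the weight spaces of the characters trivial on `ker π` finite-dimensional):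
`tr(ρ(t) | S^{ker π}) = Σ_ψ dim S[ψ ∘ π] · ψ(π t)`, the sum over the characters `ψ` of `A`.
[cite: Serre1977, §2.6 Thm. 8] [cite: BernsteinZelevinsky1976, §2.1–2.3] -/
theorem trace_fixedPoints_ker_eq_sum (hcomm : ∀ a b : K, a * b = b * a) (hπ : Function.Surjective π)
    (L : Subgroup K) (hL : π.ker = L) (hker : IsOpen (L : Set K))
    (hfin : ∀ χ : K →* ℂˣ, L ≤ χ.ker → Module.Finite ℂ (weightSpace ρ id (fun k => ((χ k : ℂˣ) : ℂ))))
    (t : K) :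
    LinearMap.trace ℂ (ρ.fixedPoints L) ((ρ t).restrict (apply_mem_fixedPoints_of_comm ρ hcomm L t)) =
      ∑ ψ : AddChar (Additive A) ℂ,
        (Module.finrank ℂ (weightSpace ρ id (fun k => ψ (Additive.ofMul (π k)))) : ℂ) * ψ (Additive.ofMul (π t)) := by
  classical
  haveI : Module.Finite ℂ (ρ.fixedPoints L) := finite_fixedPoints_of_finite_weightSpace ρ hcomm L hker hfin
  -- the representation of `A` on `S^{ker π}`: `τ(π k) = ρ(k)|`
  set s : A → K := Function.surjInv hπ with hs
  have hsπ : ∀ a, π (s a) = a := Function.surjInv_eq hπ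
  let τ : Representation ℂ A (ρ.fixedPoints L) :=
    { toFun := fun a => (ρ (s a)).restrict (apply_mem_fixedPoints_of_comm ρ hcomm L (s a))
      map_one' := by
        rw [restrict_eq_restrict_of_apply_eq ρ π hcomm L hL (k' := 1) (by rw [hsπ, map_one])]
        ext w
        simp
      map_mul' := fun a b => by
        rw [restrict_eq_restrict_of_apply_eq ρ π hcomm L hL (k' := s a * s b) (by rw [hsπ, map_mul, hsπ, hsπ])]
        ext w
        simp }
  have hτ : ∀ k : K, τ (π k) = (ρ k).restrict (apply_mem_fixedPoints_of_comm ρ hcomm L k) := fun k =>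
    restrict_eq_restrict_of_apply_eq ρ π hcomm L hL (hsπ (π k))
  have hτ' : ∀ (k : K) (w : ρ.fixedPoints L), ((τ (π k) w : ρ.fixedPoints L) : S) = ρ k w := by
    intro k w
    rw [hτ k, LinearMap.restrict_apply]
  rw [← hτ t, trace_eq_sum_finrank_weightSpace τ (π t)]
  refine Finset.sum_congr rfl fun ψ _ => ?_
  rw [mul_comm]
  congr 2
  -- `dim (S^{ker π})[ψ] = dim S[ψ ∘ π]`: the inclusion is a linear bijection
  have hmem : ∀ x : weightSpace τ id (fun a => ψ (Additive.ofMul a)),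
      ((x : ρ.fixedPoints L) : S) ∈ weightSpace ρ id (fun k => ψ (Additive.ofMul (π k))) := by
    intro x
    rw [mem_weightSpace]
    intro k
    have hx := apply_of_mem_weightSpace x.2 (π k)
    rw [id] at hx
    rw [id, ← hτ' k, hx, Submodule.coe_smul]
  let f : weightSpace τ id (fun a => ψ (Additive.ofMul a)) →ₗ[ℂ]
      weightSpace ρ id (fun k => ψ (Additive.ofMul (π k))) :=
    { toFun := fun x => ⟨((x : ρ.fixedPoints L) : S), hmem x⟩
      map_add' := fun x y => by ext; simp
      map_smul' := fun c x => by ext; simp }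
  have hinj : Function.Injective f := by
    intro x y hxy
    have h := congrArg (fun z : weightSpace ρ id (fun k => ψ (Additive.ofMul (π k))) => (z : S)) hxy
    exact Subtype.ext (Subtype.ext h)
  have hsurj : Function.Surjective f := by
    intro v
    have hvW : (v : S) ∈ ρ.fixedPoints L := mem_fixedPoints_ker_of_mem_weightSpace ρ π L hL ψ v.2
    have hvE : (⟨(v : S), hvW⟩ : ρ.fixedPoints L) ∈ weightSpace τ id (fun a => ψ (Additive.ofMul a)) := by
      rw [mem_weightSpace]
      intro a
      obtain ⟨k, rfl⟩ := hπ a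
      apply Subtype.ext
      have hv := apply_of_mem_weightSpace v.2 k
      rw [id] at hv
      rw [id, hτ' k, Submodule.coe_smul, hv]
    exact ⟨⟨⟨(v : S), hvW⟩, hvE⟩, Subtype.ext rfl⟩
  exact (LinearEquiv.ofBijective f ⟨hinj, hsurj⟩).finrank_eq

omit [TopologicalSpace K] [IsTopologicalGroup K] [CompactSpace K] [Fintype A] in
/-- A character `θ : K →* ℂˣ` trivial on `ker π` descends to a character of `A`. (Bookkeeping.) [cite: Serre1977, §2.1] -/
theorem exists_addChar_of_ker_le (hπ : Function.Surjective π) (θ : K →* ℂˣ) (hθ : π.ker ≤ θ.ker) :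
    ∃ θbar : AddChar (Additive A) ℂ, ∀ k : K, θbar (Additive.ofMul (π k)) = ((θ k : ℂˣ) : ℂ) := by
  set s : A → K := Function.surjInv hπ with hs
  have hsπ : ∀ a, π (s a) = a := Function.surjInv_eq hπ
  have hdep : ∀ k k' : K, π k = π k' → θ k = θ k' := by
    intro k k' h
    have hmem : k'⁻¹ * k ∈ θ.ker := hθ (by rw [MonoidHom.mem_ker, map_mul, map_inv, h, inv_mul_cancel])
    rw [MonoidHom.mem_ker, map_mul, map_inv, inv_mul_eq_one] at hmem
    exact hmem.symm
  refine ⟨{ toFun := fun x => ((θ (s (Additive.toMul x)) : ℂˣ) : ℂ)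
            map_zero_eq_one' := by
              rw [toMul_zero, hdep (s 1) 1 (by rw [hsπ, map_one]), map_one, Units.val_one]
            map_add_eq_mul' := fun a b => by
              rw [toMul_add, hdep (s (Additive.toMul a * Additive.toMul b)) (s (Additive.toMul a) * s (Additive.toMul b))
                (by rw [hsπ, map_mul, hsπ, hsπ]), map_mul, Units.val_mul] }, fun k => ?_⟩
  show ((θ (s (Additive.toMul (Additive.ofMul (π k)))) : ℂˣ) : ℂ) = _
  rw [toMul_ofMul, hdep (s (π k)) k (hsπ _)]

omit [TopologicalSpace K] [IsTopologicalGroup K] [CompactSpace K] [Fintype A] in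
/-- A character of `A` lifts to a character `K →* ℂˣ` trivial on `ker π`. (Bookkeeping.) [cite: Serre1977, §2.1] -/
theorem exists_monoidHom_of_addChar (ψ : AddChar (Additive A) ℂ) :
    ∃ ξ : K →* ℂˣ, π.ker ≤ ξ.ker ∧ ∀ k : K, ((ξ k : ℂˣ) : ℂ) = ψ (Additive.ofMul (π k)) := by
  refine ⟨{ toFun := fun k => Units.mk0 (ψ (Additive.ofMul (π k))) ((ψ.val_isUnit _).ne_zero)
            map_one' := by ext; simp
            map_mul' := fun a b => by ext; simp [AddChar.map_add_eq_mul] }, fun k hk => ?_, fun k => rfl⟩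
  rw [MonoidHom.mem_ker] at hk ⊢
  ext
  simp [hk]

omit [CompactSpace K] [Fintype A] in
/-- Multiplicity one for the characters `ψ ∘ π` (their kernels contain the open `ker π`). (Bookkeeping.)
[cite: BernsteinZelevinsky1976, §2.1] -/
theorem finite_and_finrank_weightSpace_comp_le (L : Subgroup K) (hL : π.ker = L) (hLo : IsOpen (L : Set K))
    (hfin : ∀ χ : K →* ℂˣ, IsOpen (χ.ker : Set K) →
      Module.Finite ℂ (weightSpace ρ id (fun k => ((χ k : ℂˣ) : ℂ))) ∧
        Module.finrank ℂ (weightSpace ρ id (fun k => ((χ k : ℂˣ) : ℂ))) ≤ 1)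
    (ψ : AddChar (Additive A) ℂ) :
    Module.Finite ℂ (weightSpace ρ id (fun k => ψ (Additive.ofMul (π k)))) ∧
      Module.finrank ℂ (weightSpace ρ id (fun k => ψ (Additive.ofMul (π k)))) ≤ 1 := by
  obtain ⟨χ, hχL, hχ⟩ := exists_monoidHom_of_addChar π ψ
  have h := hfin χ (Subgroup.isOpen_mono (by rw [← hL]; exact hχL) hLo)
  rwa [show (fun k => ((χ k : ℂˣ) : ℂ)) = fun k => ψ (Additive.ofMul (π k)) from funext hχ] at h

end Quotient

/-! ## §2. The dichotomy: complementary type sets from the finite-level character relation -/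

section Dichotomy

variable {K : Type*} [Group K] [TopologicalSpace K] [IsTopologicalGroup K] [CompactSpace K]
  {S₁ : Type*} [AddCommGroup S₁] [Module ℂ S₁] {S₂ : Type*} [AddCommGroup S₂] [Module ℂ S₂]
  (ρ₁ : Representation ℂ K S₁) (ρ₂ : Representation ℂ K S₂)

omit [TopologicalSpace K] [IsTopologicalGroup K] [CompactSpace K] in
/-- If the elements of `K` commute, every subgroup is normal. (Bookkeeping.) [folklore] -/
private theorem normal_of_comm' (hcomm : ∀ a b : K, a * b = b * a) (L : Subgroup K) : L.Normal :=
  ⟨fun n hn g => by rwa [hcomm g n, mul_inv_cancel_right]⟩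

/-- **COMPLEMENTARY TYPE SETS FROM A FINITE-LEVEL CHARACTER RELATION** (abstract half of the `(U(1), U(1))` theta
dichotomy).  `K` compact with commuting elements; `ρ₁, ρ₂` of multiplicity one (`hfin₁`, `hfin₂`); `z₁² = 1`; `θ` an
open-kernel character; (relation) every `z ∉ {1, z₁}` has an open subgroup `K₀` with
`tr(ρ₂(u) | S₂^{L}) = -θ(u) · tr(ρ₁(u) | S₁^{L})` for all `u ∈ z K₀` and all open subgroups `L ≤ K₀`; (reflection
asymmetry) for some `z` and an open subgroup `K₀ ∌ z, z₁ z`, `‖tr(ρ₁(z₁ z) | S₁^{L})‖ ≠ ‖tr(ρ₁(z) | S₁^{L})‖` for all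
open `L ≤ K₀`.  THEN `dim S₁[ξ] + dim S₂[ξ θ] = 1` for every open-kernel `ξ`: the type sets are COMPLEMENTARY up to the
shift `θ`.  (Level `L = ker ξ ∩ ker θ ∩ K₀`; `trace_fixedPoints_ker_eq_sum` at `K → K/L`; the relation at level `L` off
the cosets of `1, z₁` from deeper levels by `trace_fixedPoints_eq_average` and a finite subcover of the compact coset
`z L`; then `apply_eq_apply_of_sum_eq_zero_off_pair` and `add_eq_one_of_parity_of_norm_sum_ne`.)
[cite: BernsteinZelevinsky1976, §2.1–2.3] [cite: Serre1977, §2.3 and §2.6 Thm. 8] -/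
theorem finrank_weightSpace_add_eq_one_of_trace_eq_neg (hcomm : ∀ a b : K, a * b = b * a)
    (hfin₁ : ∀ χ : K →* ℂˣ, IsOpen (χ.ker : Set K) →
      Module.Finite ℂ (weightSpace ρ₁ id (fun k => ((χ k : ℂˣ) : ℂ))) ∧
        Module.finrank ℂ (weightSpace ρ₁ id (fun k => ((χ k : ℂˣ) : ℂ))) ≤ 1)
    (hfin₂ : ∀ χ : K →* ℂˣ, IsOpen (χ.ker : Set K) →
      Module.Finite ℂ (weightSpace ρ₂ id (fun k => ((χ k : ℂˣ) : ℂ))) ∧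
        Module.finrank ℂ (weightSpace ρ₂ id (fun k => ((χ k : ℂˣ) : ℂ))) ≤ 1)
    {z₁ : K} (hz₁ : z₁ * z₁ = 1) (θ : K →* ℂˣ) (hθ : IsOpen (θ.ker : Set K))
    (hrel : ∀ z : K, z ≠ 1 → z ≠ z₁ → ∃ K₀ : Subgroup K, IsOpen (K₀ : Set K) ∧
      ∀ u : K, z⁻¹ * u ∈ K₀ → ∀ L : Subgroup K, IsOpen (L : Set K) → L ≤ K₀ →
        LinearMap.trace ℂ (ρ₂.fixedPoints L) ((ρ₂ u).restrict (apply_mem_fixedPoints_of_comm ρ₂ hcomm L u)) =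
          -(((θ u : ℂˣ) : ℂ) *
            LinearMap.trace ℂ (ρ₁.fixedPoints L) ((ρ₁ u).restrict (apply_mem_fixedPoints_of_comm ρ₁ hcomm L u))))
    (hasym : ∃ z : K, ∃ K₀ : Subgroup K, IsOpen (K₀ : Set K) ∧ z ∉ K₀ ∧ z₁ * z ∉ K₀ ∧
      ∀ L : Subgroup K, IsOpen (L : Set K) → L ≤ K₀ →
        ‖LinearMap.trace ℂ (ρ₁.fixedPoints L)
            ((ρ₁ (z₁ * z)).restrict (apply_mem_fixedPoints_of_comm ρ₁ hcomm L (z₁ * z)))‖ ≠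
          ‖LinearMap.trace ℂ (ρ₁.fixedPoints L) ((ρ₁ z).restrict (apply_mem_fixedPoints_of_comm ρ₁ hcomm L z))‖)
    (ξ : K →* ℂˣ) (hξ : IsOpen (ξ.ker : Set K)) :
    Module.finrank ℂ (weightSpace ρ₁ id (fun k => ((ξ k : ℂˣ) : ℂ))) +
      Module.finrank ℂ (weightSpace ρ₂ id (fun k => (((ξ * θ) k : ℂˣ) : ℂ))) = 1 := by
  classical
  obtain ⟨zs, K₀s, hK₀so, hzs, hz₁zs, hasyms⟩ := hasym
  -- the level `L = ker ξ ∩ ker θ ∩ K₀⋆`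
  set L : Subgroup K := ξ.ker ⊓ θ.ker ⊓ K₀s with hLdef
  have hLo : IsOpen (L : Set K) := by
    rw [hLdef, Subgroup.coe_inf, Subgroup.coe_inf]; exact (hξ.inter hθ).inter hK₀so
  have hLξ : L ≤ ξ.ker := inf_le_left.trans inf_le_left
  have hLθ : L ≤ θ.ker := inf_le_left.trans inf_le_right
  have hLK₀ : L ≤ K₀s := inf_le_right
  haveI : L.Normal := normal_of_comm' hcomm L
  haveI : Finite (K ⧸ L) := Subgroup.quotient_finite_of_isOpen L hLo
  letI : Fintype (K ⧸ L) := Fintype.ofFinite _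
  letI : CommGroup (K ⧸ L) :=
    { (inferInstance : Group (K ⧸ L)) with
      mul_comm := fun x y => by
        obtain ⟨a, rfl⟩ := QuotientGroup.mk_surjective x
        obtain ⟨b, rfl⟩ := QuotientGroup.mk_surjective y
        rw [← QuotientGroup.mk_mul, ← QuotientGroup.mk_mul, hcomm] }
  set π : K →* K ⧸ L := QuotientGroup.mk' L
  have hπ : Function.Surjective π := QuotientGroup.mk'_surjective L
  have hπker : π.ker = L := QuotientGroup.ker_mk' L
  have hπmem : ∀ k : K, π k = 1 ↔ k ∈ L := fun k => by rw [← MonoidHom.mem_ker, hπker]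
  -- multiplicity one for the characters `ψ ∘ π`
  have hfinψ₁ := finite_and_finrank_weightSpace_comp_le ρ₁ π L hπker hLo hfin₁
  have hfinψ₂ := finite_and_finrank_weightSpace_comp_le ρ₂ π L hπker hLo hfin₂
  have hfinL₁ : ∀ χ : K →* ℂˣ, L ≤ χ.ker → Module.Finite ℂ (weightSpace ρ₁ id (fun k => ((χ k : ℂˣ) : ℂ))) :=
    fun χ hχ => (hfin₁ χ (Subgroup.isOpen_mono hχ hLo)).1
  have hfinL₂ : ∀ χ : K →* ℂˣ, L ≤ χ.ker → Module.Finite ℂ (weightSpace ρ₂ id (fun k => ((χ k : ℂˣ) : ℂ))) :=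
    fun χ hχ => (hfin₂ χ (Subgroup.isOpen_mono hχ hLo)).1
  -- the characters `θ̄`, `ξ̄` of `K/L`
  obtain ⟨θbar, hθbar⟩ := exists_addChar_of_ker_le π hπ θ (by rw [hπker]; exact hLθ)
  obtain ⟨ξbar, hξbar⟩ := exists_addChar_of_ker_le π hπ ξ (by rw [hπker]; exact hLξ)
  -- the multiplicity functions at level `L`
  set n₁ : AddChar (Additive (K ⧸ L)) ℂ → ℕ :=
    fun ψ => Module.finrank ℂ (weightSpace ρ₁ id (fun k => ψ (Additive.ofMul (π k))))
  set n₂ : AddChar (Additive (K ⧸ L)) ℂ → ℕ :=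
    fun ψ => Module.finrank ℂ (weightSpace ρ₂ id (fun k => ψ (Additive.ofMul (π k))))
  -- the trace identities at level `L`
  have hT₁ : ∀ t : K, LinearMap.trace ℂ (ρ₁.fixedPoints L)
      ((ρ₁ t).restrict (apply_mem_fixedPoints_of_comm ρ₁ hcomm L t)) =
        ∑ ψ : AddChar (Additive (K ⧸ L)) ℂ, (n₁ ψ : ℂ) * ψ (Additive.ofMul (π t)) :=
    fun t => trace_fixedPoints_ker_eq_sum ρ₁ π hcomm hπ L hπker hLo hfinL₁ t
  have hT₂ : ∀ t : K, LinearMap.trace ℂ (ρ₂.fixedPoints L)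
      ((ρ₂ t).restrict (apply_mem_fixedPoints_of_comm ρ₂ hcomm L t)) =
        ∑ ψ : AddChar (Additive (K ⧸ L)) ℂ, (n₂ ψ : ℂ) * ψ (Additive.ofMul (π t)) :=
    fun t => trace_fixedPoints_ker_eq_sum ρ₂ π hcomm hπ L hπker hLo hfinL₂ t
  -- STEP 1: the relation at level `L` for every `z` with `π z ∉ {1, π z₁}` (covering + averaging)
  have hrelL : ∀ z : K, π z ≠ 1 → π z ≠ π z₁ →
      LinearMap.trace ℂ (ρ₂.fixedPoints L) ((ρ₂ z).restrict (apply_mem_fixedPoints_of_comm ρ₂ hcomm L z)) =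
        -(((θ z : ℂˣ) : ℂ) *
          LinearMap.trace ℂ (ρ₁.fixedPoints L) ((ρ₁ z).restrict (apply_mem_fixedPoints_of_comm ρ₁ hcomm L z))) := by
    intro z hz1 hz
    -- the coset `z L`, compact
    set C : Set K := (fun l : K => z * l) '' (L : Set K)
    have hCc : IsCompact C := ((Subgroup.isClosed_of_isOpen L hLo).isCompact).image (continuous_const_mul z)
    have hCne : ∀ u ∈ C, u ≠ 1 ∧ u ≠ z₁ := by
      rintro u ⟨l, hl, rfl⟩
      refine ⟨fun h => hz1 ?_, fun h => hz ?_⟩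
      · rw [hπmem, eq_inv_of_mul_eq_one_left h]
        exact L.inv_mem hl
      · have hmem : z₁⁻¹ * z ∈ L := by
          rw [show z₁⁻¹ * z = l⁻¹ by rw [← h, mul_inv_rev, mul_assoc, inv_mul_cancel, mul_one]]
          exact L.inv_mem hl
        rw [← hπmem, map_mul, map_inv, inv_mul_eq_one] at hmem
        exact hmem.symm
    have hcov : ∀ u ∈ C, ∃ K₀ : Subgroup K, IsOpen (K₀ : Set K) ∧
        ∀ w : K, u⁻¹ * w ∈ K₀ → ∀ L' : Subgroup K, IsOpen (L' : Set K) → L' ≤ K₀ →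
          LinearMap.trace ℂ (ρ₂.fixedPoints L') ((ρ₂ w).restrict (apply_mem_fixedPoints_of_comm ρ₂ hcomm L' w)) =
            -(((θ w : ℂˣ) : ℂ) *
              LinearMap.trace ℂ (ρ₁.fixedPoints L') ((ρ₁ w).restrict (apply_mem_fixedPoints_of_comm ρ₁ hcomm L' w))) :=
      fun u hu => hrel u (hCne u hu).1 (hCne u hu).2
    choose! K₀ hK₀o hK₀rel using hcov
    -- a finite subcover of `z L` by the cosets `u K₀(u)`
    have hUo : ∀ u ∈ C, IsOpen {w : K | u⁻¹ * w ∈ (K₀ u : Set K)} := fun u hu =>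
      (hK₀o u hu).preimage (continuous_const_mul u⁻¹)
    have hUC : C ⊆ ⋃ u ∈ C, {w : K | u⁻¹ * w ∈ (K₀ u : Set K)} := fun u hu =>
      Set.mem_iUnion₂.2 ⟨u, hu, show u⁻¹ * u ∈ (K₀ u : Set K) by rw [inv_mul_cancel]; exact (K₀ u).one_mem⟩
    obtain ⟨b, hbC, hbfin, hbcov⟩ := hCc.elim_finite_subcover_image hUo hUC
    -- the deeper level `L' = L ∩ ⋂_{u ∈ b} K₀(u)`
    set L' : Subgroup K := L ⊓ ⨅ u ∈ b, K₀ u with hL'def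
    have hL'o : IsOpen (L' : Set K) := by
      have : (L' : Set K) = (L : Set K) ∩ ⋂ u ∈ b, (K₀ u : Set K) := by
        rw [hL'def, Subgroup.coe_inf, Subgroup.coe_iInf]; congr 1; ext w
        simp only [Set.mem_iInter, Subgroup.coe_iInf, SetLike.mem_coe]
      exact this ▸ hLo.inter (hbfin.isOpen_biInter fun u hu => hK₀o u (hbC hu))
    have hL'L : L' ≤ L := inf_le_left
    have hL'K₀ : ∀ u ∈ b, L' ≤ K₀ u := fun u hu =>
      inf_le_right.trans ((iInf_le _ u).trans (iInf_le _ hu))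
    haveI : Finite (L ⧸ L'.subgroupOf L) := Subgroup.quotient_finite_of_isOpen' L (L'.subgroupOf L) hLo
      (by rw [Subgroup.coe_subgroupOf]; exact hL'o.preimage continuous_subtype_val)
    letI : Fintype (L ⧸ L'.subgroupOf L) := Fintype.ofFinite _
    haveI : Module.Finite ℂ (ρ₁.fixedPoints L') := finite_fixedPoints_of_finite_weightSpace ρ₁ hcomm L' hL'o
      fun χ hχ => (hfin₁ χ (Subgroup.isOpen_mono hχ hL'o)).1
    haveI : Module.Finite ℂ (ρ₂.fixedPoints L') := finite_fixedPoints_of_finite_weightSpace ρ₂ hcomm L' hL'o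
      fun χ hχ => (hfin₂ χ (Subgroup.isOpen_mono hχ hL'o)).1
    -- the relation at every `z q̃`, `q̃ ∈ L`
    have hq : ∀ q : L ⧸ L'.subgroupOf L,
        LinearMap.trace ℂ (ρ₂.fixedPoints L')
            ((ρ₂ (z * ((q.out : L) : K))).restrict (apply_mem_fixedPoints_of_comm ρ₂ hcomm L' _)) =
          -(((θ z : ℂˣ) : ℂ) * LinearMap.trace ℂ (ρ₁.fixedPoints L')
            ((ρ₁ (z * ((q.out : L) : K))).restrict (apply_mem_fixedPoints_of_comm ρ₁ hcomm L' _))) := by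
      intro q
      have hu : z * ((q.out : L) : K) ∈ C := ⟨_, (q.out : L).2, rfl⟩
      obtain ⟨u, hub, huw⟩ := Set.mem_iUnion₂.1 (hbcov hu)
      rw [hK₀rel u (hbC hub) _ huw L' hL'o (hL'K₀ u hub), map_mul, hLθ (q.out : L).2, mul_one]
    rw [trace_fixedPoints_eq_average ρ₂ hcomm L L' hL'L z, trace_fixedPoints_eq_average ρ₁ hcomm L L' hL'L z,
      Finset.sum_congr rfl fun q _ => hq q, Finset.sum_neg_distrib, ← Finset.mul_sum]
    ring
  -- STEP 2: the character sums of `D(ψ) = n₂(ψ θ̄) + n₁(ψ)` vanish off `{1, π z₁}`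
  have hD0 : ∀ zbar : K ⧸ L, zbar ≠ 1 → zbar ≠ π z₁ →
      ∑ ψ : AddChar (Additive (K ⧸ L)) ℂ, ((n₂ (ψ * θbar) : ℂ) + n₁ ψ) * ψ (Additive.ofMul zbar) = 0 := by
    intro zbar hzb1 hzb
    obtain ⟨z, rfl⟩ := hπ zbar
    have hθz : ((θ z : ℂˣ) : ℂ) ≠ 0 := Units.ne_zero _
    -- re-index the `n₂`-sum by `ψ ↦ ψ θ̄⁻¹`
    have hre : ∑ ψ : AddChar (Additive (K ⧸ L)) ℂ, (n₂ (ψ * θbar) : ℂ) * ψ (Additive.ofMul (π z)) =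
        ((θ z : ℂˣ) : ℂ)⁻¹ * ∑ φ : AddChar (Additive (K ⧸ L)) ℂ, (n₂ φ : ℂ) * φ (Additive.ofMul (π z)) := by
      rw [Finset.mul_sum, ← Equiv.sum_comp (Equiv.mulRight θbar⁻¹)]
      refine Finset.sum_congr rfl fun φ _ => ?_
      rw [Equiv.coe_mulRight, inv_mul_cancel_right, AddChar.mul_apply, AddChar.inv_apply', hθbar]
      ring
    rw [Finset.sum_congr rfl fun ψ _ => add_mul (n₂ (ψ * θbar) : ℂ) (n₁ ψ) (ψ (Additive.ofMul (π z))),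
      Finset.sum_add_distrib, hre, ← hT₁ z, ← hT₂ z, hrelL z hzb1 hzb]
    field_simp
    ring
  -- STEP 3: `D` depends only on `ψ(π z₁)`
  have hD : ∀ ψ ψ' : AddChar (Additive (K ⧸ L)) ℂ, ψ (Additive.ofMul (π z₁)) = ψ' (Additive.ofMul (π z₁)) →
      n₂ (ψ * θbar) + n₁ ψ = n₂ (ψ' * θbar) + n₁ ψ' := by
    intro ψ ψ' h
    have := apply_eq_apply_of_sum_eq_zero_off_pair (fun ψ => ((n₂ (ψ * θbar) : ℂ) + n₁ ψ)) (π z₁) hD0 ψ ψ' h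
    exact_mod_cast this
  -- STEP 4: the reflection asymmetry at level `L`, and the combinatorial core
  have hzs1 : π zs ≠ 1 := fun h => hzs (hLK₀ ((hπmem zs).1 h))
  have hzsz : π zs ≠ π z₁ := fun h => hz₁zs (hLK₀ ((hπmem _).1 (by rw [map_mul, h, ← map_mul, hz₁, map_one])))
  have hasymL : ‖∑ ψ : AddChar (Additive (K ⧸ L)) ℂ, (n₁ ψ : ℂ) * ψ (Additive.ofMul (π z₁ * π zs))‖ ≠
      ‖∑ ψ : AddChar (Additive (K ⧸ L)) ℂ, (n₁ ψ : ℂ) * ψ (Additive.ofMul (π zs))‖ := by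
    rw [← map_mul, ← hT₁ (z₁ * zs), ← hT₁ zs]
    exact hasyms L hLo hLK₀
  have hcore := add_eq_one_of_parity_of_norm_sum_ne n₁ n₂ (fun ψ => (hfinψ₁ ψ).2) (fun ψ => (hfinψ₂ ψ).2)
    (z₁ := π z₁) (by rw [← map_mul, hz₁, map_one]) θbar hD hzs1 hzsz hasymL ξbar
  -- STEP 5: read the conclusion at `ψ = ξ̄`
  have hw₁ : (fun k => ξbar (Additive.ofMul (π k))) = fun k => ((ξ k : ℂˣ) : ℂ) := funext hξbar
  have hw₂ : (fun k => (ξbar * θbar) (Additive.ofMul (π k))) = fun k => (((ξ * θ) k : ℂˣ) : ℂ) := by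
    funext k
    rw [AddChar.mul_apply, hξbar, hθbar, MonoidHom.mul_apply, Units.val_mul]
  have h1 : n₁ ξbar = Module.finrank ℂ (weightSpace ρ₁ id (fun k => ((ξ k : ℂˣ) : ℂ))) := by
    show Module.finrank ℂ (weightSpace ρ₁ id (fun k => ξbar (Additive.ofMul (π k)))) = _; rw [hw₁]
  have h2 : n₂ (ξbar * θbar) = Module.finrank ℂ (weightSpace ρ₂ id (fun k => (((ξ * θ) k : ℂˣ) : ℂ))) := by
    show Module.finrank ℂ (weightSpace ρ₂ id (fun k => (ξbar * θbar) (Additive.ofMul (π k)))) = _; rw [hw₂]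
  rw [← h1, ← h2, add_comm]
  exact hcore

end Dichotomy

end Literature.RepresentationTheory.TwistedCoinv

end
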